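import Literature.Algebra.EuclideanLattices.RegevRoutineCore
import Literature.Computability.Complexity.CodeFPLists
import HarnessLib

/-!
# Regev's per-copy routine as a circuit family, X: the block functions are polynomial time

Tenth file of the circuit-level construction towards the discharge of
`Literature.Algebra.EuclideanLattices.usvp_of_dihedralCoset` (O. Regev, *Quantum computation and
lattice problems*, SIAM J. Comput. 33 (2004), Thm. 1.1). The outputs `wOut`, `vOut` of the two
blocks of the routine (file IX) are computed on the codes of the parsed records by polynomial-time
string functions, assembled in the typed `FP` algebra `CodeFP` (`Computability/Complexity/
CodeFP*.lean`) from: the canonicaliser of payload codes (`cPayload`, file IX), string slicing and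
values (`strTake`, `strDrop`, `strVal`, `strChunks`), arithmetic, the ranking/unranking and the
coin count of the quantised ball (`Regev2004.unrankFP`, `rankFP`, `kappaFP`,
`RegevPointSetUnrankFP.lean`) and the list program of `c ᵥ* B` (`Regev2004.vecMulLFP`,
`RegevCandidateSelection.lean`):

* `ctxE` and the shared computations on the context `(L, x, g, ta)`: `nOf_codeFP`,
  `payloadOf_codeFP` (+ fields), `readGuess…_codeFP`, `radius_codeFP`, `numIdx_codeFP`,
  `liveCore_codeFP`, `ctrlBit_codeFP`, `digitsOf_codeFP`, `coeffsOf_codeFP`, `latticeOf_codeFP`;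
* **`wOut_codeFP`** — `CodeFP inWE strE (wOutE ∘ wOut)` on the record `⟨1^L, ⟨ix, ⟨ta, ⟨x, ⟨g, 1^k⟩⟩⟩⟩⟩`
  of `parseW`;
* **`vOut_codeFP`** — `CodeFP inVE strE vOut` on the record `⟨1^L, ⟨ta, ⟨x, ⟨g, ⟨1^k, wOutE o⟩⟩⟩⟩⟩`
  of `parseV`.

No named fact is introduced.

## References

* O. Regev, *Quantum computation and lattice problems*, SIAM J. Comput. 33 (2004) 738–760, proof
  of Lemma 3.12 (p. 14: the routine runs in polynomial time) [Regev2004].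
* S. Arora, B. Barak, *Computational Complexity: A Modern Approach*, CUP 2009, §1.3 [AroraBarak2009].
-/

noncomputable section

set_option maxHeartbeats 800000

namespace Literature.Algebra.EuclideanLattices

namespace RegevRoutine

open _root_.Computability Polynomial Literature.Computability.Complexity Literature.Computability.Complexity.Brick
  Literature.Computability.Complexity.CanonCode Literature.Computability.Complexity.CodeFP Plumb Regev2004

/-! ### Encoders and generic pieces -/

/-- The `CodeFP` encoder of payloads. [folklore] -/
abbrev plE : Payload → List Bool := pairE (listE (listE smE)) (pairE natE (pairE natE (listE natE)))

/-- The Boolean encoding of payloads is `plE`. [folklore] -/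
theorem ePayload_encode_eq : (ePayload.encode : Payload → List Bool) = plE := by
  rw [ePayload, pairE_eq, pairE_eq, pairE_eq, listE_eq, listE_eq, listE_eq, natE_eq]
  rfl

/-- The context `(L, (x, (g, ta)))` shared by the two blocks. [folklore] -/
abbrev Ctx : Type := ℕ × (List Bool × (List Bool × List Bool))

/-- The encoder of contexts. [folklore] -/
abbrev ctxE : Ctx → List Bool := pairE unE (pairE strE (pairE strE strE))

/-- A fixed polynomial of the unary input. [cite: AroraBarak2009, §1.3] -/
theorem unPoly (Q : Polynomial ℕ) : CodeFP unE unE (fun L => Q.eval L) :=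
  of_fn (polyFn Q) (polyFn_mem_FP Q) fun L => by
    rw [polyFn_apply, unE_eq_ones, unE_eq_ones]
    simp [ones]

/-- The bit length of a numeral (a twin of `natSizeU_codeFP` of `QuantumComplexity/HidingProgramMachine.lean`, outside
this file's imports). [folklore] -/
theorem size_codeFP : CodeFP natE unE Nat.size :=
  (strLength.comp strOfNat).congr fun n => TM2Pass.length_encodeNat_eq_size n

/-- The head bit of a string. [folklore] -/
theorem headD_codeFP : CodeFP strE bitE (fun s : List Bool => s.headD false) :=
  of_fn HashBricks.headBitFn HashBricks.headBitFn_mem_FP fun s => by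
    rw [headBitFn_eq_encodeBool_decodeBool]
    cases s <;> rfl

/-- A block of zeros of unary length (a twin of `TQBFRed.strZeros` of the barrier tree, not importable here). [folklore] -/
theorem zeros_codeFP : CodeFP unE strE (fun n => List.replicate n false) :=
  of_fn Kannan.zerosFn Kannan.zerosFn_mem_FP fun n => by
    rw [Kannan.zerosFn_apply, unE_eq_ones]
    simp [ones, strE]

/-- Taking up to the capped count is taking up to the count. [folklore] -/
theorem take_min_length (l : List Bool) (n : ℕ) : l.take (min n l.length) = l.take n := by
  rw [List.take_eq_take_iff]; omega

/-- Dropping from the capped count is dropping from the count (a twin of `Lem75Q.drop_min_length` of the barrier tree,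
not importable here). [folklore] -/
theorem drop_min_length (l : List Bool) (n : ℕ) : l.drop (min n l.length) = l.drop n := by
  rcases le_total n l.length with h | h
  · rw [min_eq_left h]
  · rw [min_eq_right h, List.drop_length, List.drop_eq_nil_of_le h]

/-! ### The shared computations on the context -/

section Shared

variable (S : Sizes)

/-- `n = nOf L` in binary. [folklore] -/
theorem nOf_codeFP : CodeFP ctxE natE (fun c => nOf c.1) := by
  have h := (natSub.comp ((natOfUn.comp (fst unE (pairE strE (pairE strE strE)))).pair (natMul.comp ((natSqrt.comp (natOfUn.comp
    (fst unE (pairE strE (pairE strE strE))))).pair (natSqrt.comp (natOfUn.comp (fst unE (pairE strE (pairE strE strE)))))))) :)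
  exact h.congr fun c => by simp only [id, nOf, pow_two]

/-- `n` in unary. [folklore] -/
theorem nOfUn_codeFP : CodeFP ctxE unE (fun c => nOf c.1) := by
  have h := (unOfNatMin.comp ((fst unE (pairE strE (pairE strE strE))).pair nOf_codeFP) :)
  exact h.congr fun _ => min_eq_left (nOf_le _)

/-- **The payload, decoded** (through the canonicaliser of its code). [folklore] -/
theorem payloadOf_codeFP : CodeFP ctxE plE (fun c => payloadOf c.2.1) :=
  (of_fn (cPayload ∘ fstF) (comp_mem_FP cPayload_mem_FP fstF_mem_FP) (fun w => by
    rw [Function.comp_apply, cPayload_eq, ePayload_encode_eq]; rfl) : CodeFP strE plE payloadOf).comp (snd _ _).fst'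

/-- The rows of the basis, as raw lists of integers. [folklore] -/
theorem rows_codeFP : CodeFP ctxE (rawE (rawE intE)) (fun c => (payloadOf c.2.1).rows) := by
  have h := ((map₀ ((map₀ intOfSM).comp (rawOfList smE))).comp ((rawOfList (listE smE)).comp payloadOf_codeFP.fst') :)
  exact h.congr fun c => by simp

/-- The modulus `p`. [folklore] -/
theorem modP_codeFP : CodeFP ctxE natE (fun c => (payloadOf c.2.1).modP) := payloadOf_codeFP.snd'.fst'

/-- The number of levels `Q`. [folklore] -/
theorem levels_codeFP : CodeFP ctxE natE (fun c => (payloadOf c.2.1).levels) := payloadOf_codeFP.snd'.snd'.fst'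

/-- The capped number of levels, in unary. [folklore] -/
theorem qLevelsUn_codeFP : CodeFP ctxE unE (fun c => qLevels c.1 (payloadOf c.2.1)) :=
  unOfNatMin.comp ((fst _ _).pair levels_codeFP)

/-- The table of cell sizes, raw. [folklore] -/
theorem radii_codeFP : CodeFP ctxE (rawE natE) (fun c => (payloadOf c.2.1).radii) :=
  ((rawOfList natE).comp payloadOf_codeFP.snd'.snd'.snd').congr fun _ => rfl

/-- The guess zone. [folklore] -/
theorem gStr_codeFP : CodeFP ctxE strE (fun c => c.2.2.1) := (snd _ _).snd'.fst'

/-- The `ta` field. [folklore] -/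
theorem taStr_codeFP : CodeFP ctxE strE (fun c => c.2.2.2) := (snd _ _).snd'.snd'

/-- The register-count bound `pr(ell L) + 1` in binary. [folklore] -/
theorem rmaxOf_codeFP : CodeFP ctxE natE (fun c => S.pr.eval (ell c.1) + 1) := by
  have h := (natOfUn.comp ((unPoly (S.pr.comp ellPoly + 1)).comp (fst unE (pairE strE (pairE strE strE)))) :)
  exact h.congr fun c => by simp [eval_comp]

/-- The four field widths. [folklore] -/
theorem widths_codeFP :
    CodeFP ctxE unE (fun c => (widths S c.1 (payloadOf c.2.1)).1) ∧ CodeFP ctxE unE (fun c => (widths S c.1 (payloadOf c.2.1)).2.1) ∧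
      CodeFP ctxE unE (fun c => (widths S c.1 (payloadOf c.2.1)).2.2.1) ∧ CodeFP ctxE unE (fun c => (widths S c.1 (payloadOf c.2.1)).2.2.2) :=
  ⟨size_codeFP.comp ((natLength natE).comp radii_codeFP), size_codeFP.comp modP_codeFP, size_codeFP.comp nOf_codeFP,
    size_codeFP.comp (rmaxOf_codeFP S)⟩

/-- A guess field: the value of `w` bits of `g` after `off` bits. [folklore] -/
theorem field_codeFP {w off : Ctx → ℕ} (hw : CodeFP ctxE unE w) (hoff : CodeFP ctxE unE off) :
    CodeFP ctxE natE (fun c => bitsToNat ((c.2.2.1.drop (off c)).take (w c))) :=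
  strVal.comp (strTake.comp (hw.pair (strDrop.comp (hoff.pair gStr_codeFP))))

/-- **The guesses.** [cite: Regev2004, Thm. 1.1 (proof, p. 7)] -/
theorem readGuess_codeFP :
    CodeFP ctxE natE (fun c => (readGuess S c.1 (payloadOf c.2.1) c.2.2.1).rho) ∧
      CodeFP ctxE natE (fun c => (readGuess S c.1 (payloadOf c.2.1) c.2.2.1).m) ∧
        CodeFP ctxE natE (fun c => (readGuess S c.1 (payloadOf c.2.1) c.2.2.1).i0) ∧
          CodeFP ctxE natE (fun c => (readGuess S c.1 (payloadOf c.2.1) c.2.2.1).r') := by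
  obtain ⟨h1, h2, h3, h4⟩ := widths_codeFP S
  have erho := (strVal.comp (strTake.comp (h1.pair gStr_codeFP)) :)
  have em := field_codeFP h2 h1
  have ei0 := field_codeFP h3 (unAdd.comp (h1.pair h2))
  have er' := field_codeFP h4 (unAdd.comp ((unAdd.comp (h1.pair h2)).pair h3))
  exact ⟨erho.congr fun _ => rfl, em.congr fun _ => rfl, ei0.congr fun _ => rfl, er'.congr fun _ => rfl⟩

/-- **The cell size `Δ`.** [folklore] -/
theorem radius_codeFP : CodeFP ctxE natE (fun c => radius (payloadOf c.2.1) (readGuess S c.1 (payloadOf c.2.1) c.2.2.1)) := by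
  have h := (natMax.comp ((const ctxE (eβ := natE) 1).pair ((rawGetD natE (d := 0) rfl).comp (radii_codeFP.pair (readGuess_codeFP S).1))) :)
  exact h.congr fun _ => rfl

/-- **The number of index coins `κ`.** [cite: Regev2004, Lemma 3.11 (exact variant)] -/
theorem numIdx_codeFP : CodeFP ctxE natE (fun c => numIdx c.1 (payloadOf c.2.1) (readGuess S c.1 (payloadOf c.2.1) c.2.2.1)) := by
  have h := (kappaFP.comp (nOfUn_codeFP.pair (qLevelsUn_codeFP.pair (radius_codeFP S))) :)
  exact h.congr fun _ => rfl

/-- The context part of liveness (everything but `k < r'`), as a bit. [folklore] -/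
def liveCore (S : Sizes) (c : Ctx) : Bool :=
  decide (numIdx c.1 (payloadOf c.2.1) (readGuess S c.1 (payloadOf c.2.1) c.2.2.1) ≤ S.pkap.eval c.1) &&
    (decide ((readGuess S c.1 (payloadOf c.2.1) c.2.2.1).i0 < nOf c.1) &&
      (decide (0 < (readGuess S c.1 (payloadOf c.2.1) c.2.2.1).m) &&
        (decide ((readGuess S c.1 (payloadOf c.2.1) c.2.2.1).m < (payloadOf c.2.1).modP) &&
          (decide ((readGuess S c.1 (payloadOf c.2.1) c.2.2.1).rho < (payloadOf c.2.1).radii.length) && decide (1 ≤ nOf c.1)))))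

/-- `liveCore` is computable on codes. [folklore] -/
theorem liveCore_codeFP : CodeFP ctxE bitE (liveCore S) := by
  obtain ⟨hrho, hm, hi0, -⟩ := readGuess_codeFP S
  have h1 := (natLeUn.comp ((numIdx_codeFP S).pair ((unPoly S.pkap).comp (fst unE (pairE strE (pairE strE strE))))) :)
  have h2 := (natLt.comp (hi0.pair nOf_codeFP) :)
  have h3 := (natLt.comp ((const ctxE (eβ := natE) 0).pair hm) :)
  have h4 := (natLt.comp (hm.pair modP_codeFP) :)
  have h5 := (natLt.comp (hrho.pair ((natLength natE).comp radii_codeFP)) :)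
  have h6 := (natLe.comp ((const ctxE (eβ := natE) 1).pair nOf_codeFP) :)
  exact (h1.and (h2.and (h3.and (h4.and (h5.and h6))))).congr fun _ => rfl

/-- **Liveness** as `[k < r'] ∧ liveCore`. [folklore] -/
theorem decide_live_eq (c : Ctx) (k : ℕ) :
    decide (Live S c.1 (payloadOf c.2.1) (readGuess S c.1 (payloadOf c.2.1) c.2.2.1) k) =
      (decide (k < (readGuess S c.1 (payloadOf c.2.1) c.2.2.1).r') && liveCore S c) := by
  unfold Live liveCore
  simp only [Bool.decide_and]

/-- The control bit. [folklore] -/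
theorem ctrlBit_codeFP : CodeFP ctxE bitE (fun c => ctrlBit c.2.2.2) := headD_codeFP.comp taStr_codeFP

/-- `4n` and `4n + 1` in unary. [folklore] -/
theorem fourN_codeFP : CodeFP ctxE unE (fun c => 4 * nOf c.1) ∧ CodeFP ctxE unE (fun c => 4 * nOf c.1 + 1) := by
  have h2 := (unAdd.comp (nOfUn_codeFP.pair nOfUn_codeFP) :)
  have h4 : CodeFP ctxE unE (fun c => 4 * nOf c.1) := (unAdd.comp (h2.pair h2)).congr fun c => by dsimp only; omega
  exact ⟨h4, unSucc.comp h4⟩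

/-- **The digits `ā`.** [cite: Regev2004, Lemma 3.12 (proof, p. 14)] -/
theorem digitsOf_codeFP : CodeFP ctxE (rawE natE) (fun c => digitsOf (nOf c.1) c.2.2.2) := by
  obtain ⟨h4, h41⟩ := fourN_codeFP
  have hchunks := (strChunks.comp (nOfUn_codeFP.pair (h41.pair (strDrop.comp ((const ctxE (eβ := unE) 1).pair taStr_codeFP)))) :)
  have hitem : CodeFP (pairE unE strE) natE (fun q => bitsToNat (q.2.take q.1)) := strVal.comp strTake
  have h := ((map hitem).comp (h4.pair hchunks) :)
  exact h.congr fun c => by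
    simp only [digitsOf, List.map_map]
    refine List.map_congr_left fun i _ => ?_
    simp only [Function.comp_apply, List.take_take]
    congr 2
    omega

/-- **Regev's coefficient vector.** [cite: Regev2004, Lemma 3.4 (proof, p. 8)] -/
theorem coeffsOf_codeFP :
    CodeFP ctxE (rawE intE) (fun c => coeffsOf (payloadOf c.2.1).modP (readGuess S c.1 (payloadOf c.2.1) c.2.2.1).m
      (readGuess S c.1 (payloadOf c.2.1) c.2.2.1).i0 (ctrlBit c.2.2.2) (digitsOf (nOf c.1) c.2.2.2)) := by
  obtain ⟨-, hm, hi0, -⟩ := readGuess_codeFP S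
  have haZ := ((map₀ intOfNat).comp digitsOf_codeFP :)
  have hai0 := ((rawGetD natE (d := 0) rfl).comp (digitsOf_codeFP.pair hi0) :)
  have hmul := (intMul.comp ((intOfNat.comp hai0).pair (intOfNat.comp modP_codeFP)) :)
  have hadd := (CodeFP.ite ctrlBit_codeFP (intOfNat.comp hm) (const ctxE (eβ := intE) (0 : ℤ)) :)
  have hval := (intAdd.comp (hmul.pair hadd) :)
  have h := ((setAt intE).comp (haZ.pair (hi0.pair hval)) :)
  exact h.congr fun c => rfl

/-- **The lattice point `f(t, ā)`.** [cite: Regev2004, Lemma 3.4 (proof, p. 8)] -/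
theorem latticeOf_codeFP : CodeFP ctxE (rawE intE) (fun c => latticeOf c.1 (payloadOf c.2.1) (readGuess S c.1 (payloadOf c.2.1) c.2.2.1) c.2.2.2) := by
  have h := (vecMulLFP.comp (nOfUn_codeFP.pair ((coeffsOf_codeFP S).pair rows_codeFP)) :)
  exact h.congr fun _ => rfl

end Shared

/-! ### The first block -/

section BlockW

variable (S : Sizes)

/-- The record of `parseW`: `(L, (ix, (ta, (x, (g, k)))))`. [folklore] -/
abbrev WIn : Type := ℕ × (List Bool × (List Bool × (List Bool × (List Bool × ℕ))))

/-- Its encoder. [folklore] -/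
abbrev inWE : WIn → List Bool := pairE unE (pairE strE (pairE strE (pairE strE (pairE strE unE))))

/-- The encoder of the first block's output record. [folklore] -/
abbrev woE : WOut → List Bool := pairE (listE smE) (pairE strE (pairE strE strE))

/-- The context of a `W`-record. [folklore] -/
def WIn.ctx (r : WIn) : Ctx := (r.1, (r.2.2.2.1, (r.2.2.2.2.1, r.2.2.1)))

/-- The context of a `W`-record, on codes. [folklore] -/
theorem wCtx_codeFP : CodeFP inWE ctxE WIn.ctx :=
  (fst _ _).pair ((snd _ _).snd'.snd'.fst'.pair ((snd _ _).snd'.snd'.snd'.fst'.pair (snd _ _).snd'.fst'))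

/-- **The first block's output record, on codes.** [cite: Regev2004, Lemma 3.12 (proof, p. 14)] -/
theorem wOutRec_codeFP : CodeFP inWE woE (fun r => wOut S r.1 r.2.2.2.1 r.2.2.2.2.1 r.2.1 r.2.2.1 r.2.2.2.2.2) := by
  have hctx := wCtx_codeFP
  have rix : CodeFP inWE strE (fun r => r.2.1) := (snd _ _).fst'
  have rta : CodeFP inWE strE (fun r => r.2.2.1) := (snd _ _).snd'.fst'
  have rkN : CodeFP inWE natE (fun r => r.2.2.2.2.2) := natOfUn.comp (snd _ _).snd'.snd'.snd'.snd'
  obtain ⟨-, -, -, hr'⟩ := readGuess_codeFP S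
  -- liveness
  have hlive0 := ((natLt.comp (rkN.pair (hr'.comp hctx))).and ((liveCore_codeFP S).comp hctx) :)
  have hlive : CodeFP inWE bitE (fun r => decide (Live S r.1 (payloadOf r.2.2.2.1) (readGuess S r.1 (payloadOf r.2.2.2.1) r.2.2.2.2.1) r.2.2.2.2.2)) :=
    hlive0.congr fun r => (decide_live_eq S r.ctx r.2.2.2.2.2).symm
  -- the index coins and the grid point
  have hκ := ((numIdx_codeFP S).comp hctx :)
  have hκU := (unOfNatMin.comp ((strLength.comp rix).pair hκ) :)
  have hidx0 := (strVal.comp (strTake.comp (hκU.pair rix)) :)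
  have hidx : CodeFP inWE natE (fun r => bitsToNat (r.2.1.take (numIdx r.1 (payloadOf r.2.2.2.1) (readGuess S r.1 (payloadOf r.2.2.2.1) r.2.2.2.2.1)))) :=
    hidx0.congr fun r => by simp only [WIn.ctx, take_min_length]
  have hurest0 := (strDrop.comp (hκU.pair rix) :)
  have hurest : CodeFP inWE strE (fun r => r.2.1.drop (numIdx r.1 (payloadOf r.2.2.2.1) (readGuess S r.1 (payloadOf r.2.2.2.1) r.2.2.2.2.1))) :=
    hurest0.congr fun r => by simp only [WIn.ctx, drop_min_length]
  have hpt0 := (unrankFP.comp ((nOfUn_codeFP.comp hctx).pair ((qLevelsUn_codeFP.comp hctx).pair (((radius_codeFP S).comp hctx).pair hidx))) :)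
  have hpt : CodeFP inWE (rawE intE) (fun r => pointOf r.1 (payloadOf r.2.2.2.1) (readGuess S r.1 (payloadOf r.2.2.2.1) r.2.2.2.2.1) r.2.1) :=
    hpt0.congr fun r => rfl
  -- the measured value
  have hadd : CodeFP (pairE unitE (pairE intE intE)) intE (fun q : Unit × (ℤ × ℤ) => q.2.1 + q.2.2) := intAdd.comp (snd _ _)
  have hval0 := ((CodeFP.zipWith hadd).comp ((const inWE (eβ := unitE) ()).pair (((latticeOf_codeFP S).comp hctx).pair hpt)) :)
  have hval : CodeFP inWE (rawE intE) (fun r => valueOf r.1 (payloadOf r.2.2.2.1) (readGuess S r.1 (payloadOf r.2.2.2.1) r.2.2.2.2.1) r.2.1 r.2.2.1) :=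
    hval0.congr fun r => rfl
  have hF0 := ((listOfRaw smE).comp ((map₀ smOfInt).comp hval) :)
  have hF : CodeFP inWE (listE smE) (fun r => valueOf r.1 (payloadOf r.2.2.2.1) (readGuess S r.1 (payloadOf r.2.2.2.1) r.2.2.2.2.1) r.2.1 r.2.2.1) :=
    hF0.congr fun r => by simp
  -- assemble
  have hlv := (hF.pair (hurest.pair ((const inWE (eβ := strE) ([] : List Bool)).pair (const inWE (eβ := strE) ([] : List Bool)))) :)
  have hdd := ((const inWE (eβ := listE smE) ([] : List ℤ)).pair ((const inWE (eβ := strE) ([] : List Bool)).pair (rix.pair rta)) :)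
  have hall := (CodeFP.ite hlive hlv hdd :)
  exact hall.congr fun r => by
    unfold wOut
    by_cases h : Live S r.1 (payloadOf r.2.2.2.1) (readGuess S r.1 (payloadOf r.2.2.2.1) r.2.2.2.2.1) r.2.2.2.2.2
    · rw [if_pos h, if_pos (decide_eq_true h)]
    · rw [if_neg h, if_neg (by rw [decide_eq_false h]; exact Bool.false_ne_true)]

/-- **The first block's output, on codes.** [cite: Regev2004, Lemma 3.12 (proof, p. 14)] -/
theorem wOut_codeFP : CodeFP inWE strE (fun r => wOutE (wOut S r.1 r.2.2.2.1 r.2.2.2.2.1 r.2.1 r.2.2.1 r.2.2.2.2.2)) :=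
  ((wOutRec_codeFP S).pair (const inWE (eβ := unitE) ())).recodeOut (eγ := strE) fun _ => rfl

end BlockW

/-! ### The second block -/

section BlockV

variable (S : Sizes)

/-- The record of `parseV`: `(L, (ta, (x, (g, (k, o)))))`, `o` the first block's output record. [folklore] -/
abbrev VIn : Type := ℕ × (List Bool × (List Bool × (List Bool × (ℕ × WOut))))

/-- Its encoder: the first block's output is seen as the string it wrote. [folklore] -/
abbrev inVE : VIn → List Bool := pairE unE (pairE strE (pairE strE (pairE strE (pairE unE wOutE))))

/-- The context of a `V`-record. [folklore] -/
def VIn.ctx (v : VIn) : Ctx := (v.1, (v.2.2.1, (v.2.2.2.1, v.2.1)))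

/-- The context of a `V`-record, on codes. [folklore] -/
theorem vCtx_codeFP : CodeFP inVE ctxE VIn.ctx :=
  (fst _ _).pair ((snd _ _).snd'.fst'.pair ((snd _ _).snd'.snd'.fst'.pair (snd _ _).fst'))

/-- Reading the first block's output record off the string it wrote. [folklore] -/
theorem wOutE_codeFP : CodeFP wOutE woE id := of_fn fstF fstF_mem_FP fun o => by simp [wOutE]

/-- **The second block's output, on codes.** [cite: Bennett1973, §2 (recompute what is to be erased)] -/
theorem vOut_codeFP : CodeFP inVE strE (fun v => vOut S v.1 v.2.2.1 v.2.2.2.1 v.2.1 v.2.2.2.2.1 v.2.2.2.2.2) := by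
  have hctx := vCtx_codeFP
  have vkN : CodeFP inVE natE (fun v => v.2.2.2.2.1) := natOfUn.comp (snd _ _).snd'.snd'.snd'.fst'
  have vo : CodeFP inVE woE (fun v => v.2.2.2.2.2) := (wOutE_codeFP.comp (snd _ _).snd'.snd'.snd'.snd').congr fun _ => rfl
  have vo1 := ((map₀ intOfSM).comp ((rawOfList smE).comp vo.fst') :)
  have vo21 : CodeFP inVE strE (fun v => v.2.2.2.2.2.2.1) := vo.snd'.fst'
  have vo221 : CodeFP inVE strE (fun v => v.2.2.2.2.2.2.2.1) := vo.snd'.snd'.fst'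
  have vo222 : CodeFP inVE strE (fun v => v.2.2.2.2.2.2.2.2) := vo.snd'.snd'.snd'
  obtain ⟨-, -, -, hr'⟩ := readGuess_codeFP S
  -- liveness
  have hlive0 := ((natLt.comp (vkN.pair (hr'.comp hctx))).and ((liveCore_codeFP S).comp hctx) :)
  have hlive : CodeFP inVE bitE (fun v => decide (Live S v.1 (payloadOf v.2.2.1) (readGuess S v.1 (payloadOf v.2.2.1) v.2.2.2.1) v.2.2.2.2.1)) :=
    hlive0.congr fun v => (decide_live_eq S v.ctx v.2.2.2.2.1).symm
  -- `x̄ = F − f(t, ā)` and its rank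
  have hsub : CodeFP (pairE unitE (pairE intE intE)) intE (fun q : Unit × (ℤ × ℤ) => q.2.1 - q.2.2) := intSub.comp (snd _ _)
  have hdiff := ((CodeFP.zipWith hsub).comp ((const inVE (eβ := unitE) ()).pair (vo1.pair ((latticeOf_codeFP S).comp hctx))) :)
  have hrank := (rankFP.comp ((nOfUn_codeFP.comp hctx).pair ((qLevelsUn_codeFP.comp hctx).pair (((radius_codeFP S).comp hctx).pair hdiff))) :)
  -- the low bits of the rank, at the capped width
  have hκ := ((numIdx_codeFP S).comp hctx :)
  have hK := (unOfNatMin.comp (((unPoly S.pkap).comp (fst unE (pairE strE (pairE strE (pairE strE (pairE unE wOutE)))))).pair hκ) :)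
  have hlow := (strTake.comp (hK.pair (strAppend.comp ((strOfNat.comp hrank).pair (zeros_codeFP.comp hK)))) :)
  -- the empty mask
  have hsig := (zeros_codeFP.comp ((unPoly sigPoly).comp (fst unE (pairE strE (pairE strE (pairE strE (pairE unE wOutE)))))) :)
  -- assemble
  have hlv := (strAppend.comp (hlow.pair (strAppend.comp (vo21.pair hsig))) :)
  have hdd := (strAppend.comp (vo221.pair vo222) :)
  have hall := (CodeFP.ite hlive hlv hdd :)
  exact hall.congr fun v => by
    unfold vOut
    by_cases h : Live S v.1 (payloadOf v.2.2.1) (readGuess S v.1 (payloadOf v.2.2.1) v.2.2.2.1) v.2.2.2.2.1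
    · rw [if_pos h, if_pos (decide_eq_true h)]
      simp only [VIn.ctx, lowBits, eval_sigPoly, id]
      congr 1
      simp
    · rw [if_neg h, if_neg (by rw [decide_eq_false h]; exact Bool.false_ne_true)]

end BlockV


end RegevRoutine

end Literature.Algebra.EuclideanLattices

end
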